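import Literature.Computability.Complexity.ExtMonotoneCircuits
import Literature.Computability.Complexity.MonotoneSwitching
import Literature.Computability.Complexity.CliqueTestGraphs
import Literature.Computability.Complexity.CircuitLowerBoundsProofs
import Mathlib

/-!
# Helpers for the stubs `stub_algebraicReplaceable` / `stub_convReplaceable` of the line
`width-threshold-certificate-sparsity` (crux `ConvexRankGates.CliqueExtLowerBound`, item 10682)

Both open stubs ask, for a wide gate `φ` fed with local child pairs (`D j` an `(r-1)`-DNF below
`C j` an `(s-1)`-CNF over the edge slots), for a REPLACEMENT: a `{∧₂, ∨₂, 0, 1}`-circuit `Ψ` on the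
input positions of `φ` with `≤ m^a` gates such that `φ(D(x)) = 1 ∧ Ψ(D(x)) = 0` for at most
`ε · #P` positives `x ∈ P` and `Ψ(C(x)) = 1 ∧ φ(C(x)) = 0` for at most `ε · #N` negatives `x ∈ N`.
Proved here: the GENERAL PART of both stubs (nothing depends on the gate class), for any truth
table `f : (Fin n → Bool) → Bool`, push-forwards `dv cv : (ι → Bool) → (Fin n → Bool)` (in the
stubs `fun x j => decide (EvalDNF (D j) x)` / `decide (EvalCNF (C j) x)`), families `P N`, `ε ≥ 0`:
* DOMINANCE: `Ψ ≥ f` on the positive patterns empties the positive-side error set, `Ψ ≤ f` on the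
  negative patterns the negative-side one (`exists_replacement_of_upper`, `_of_lower`).
* NON-DISTINGUISHER: if `f ∘ dv` accepts `≤ ε · #P` positives the constant `0` replaces `f`
  (`exists_replacement_of_pos_blind`); if `f ∘ cv` rejects `≤ ε · #N` negatives the constant `1`
  does (`exists_replacement_of_neg_blind`); both conditions are also NECESSARY for the respective
  constant (`const_false_pos_error_eq`, `const_true_neg_error_eq`): a gate with no constant
  replacement is an `(ε, ε)`-DISTINGUISHER of `(P, N)`.
* EXACT CASE: a gate computed by a `{∧₂, ∨₂, 0, 1}`-circuit `Ψ` is replaced by `Ψ` with zero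
  error (`exists_replacement_of_computes`).
* CERTIFICATES: monotone DNFs / CNFs over the input positions are small circuits
  (`exists_circuit_dnf`, `exists_circuit_cnf`); an AND of sound rejection certificates with small
  uncertified negative mass replaces `f` ("certificate sparsity", `exists_replacement_of_cuts`); an
  OR of terms below `f` capturing almost all accepted positives replaces `f` ("effective minterm
  width", `exists_replacement_of_minterms`).
* CANONICAL SANDWICHES for MONOTONE `f` (all PERM/GRANK/CONV gates are): the OR of accepted
  PATTERNS lies below `f`, the AND of the co-clauses of rejected patterns lies above `f`, with ZERO
  error on those patterns; so `f` is replaceable at cost `(#children + 2) · #T + 1` up to the mass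
  of the patterns left out of `T` (`exists_replacement_of_posPatterns`, `_of_negPatterns`). The open
  residue of the stubs is thus the monotone complexity of ONE explicit partial function: `1` on
  `{dv x : x ∈ P, φ(dv x) = 1}`, `0` on `{cv x : x ∈ N, φ(cv x) = 0}`, up to `ε`-mass on each side.
* `conclusion_of_cheap_exit`: the conclusion of the two stubs, verbatim, from any cheap exit.
-/

set_option linter.dupNamespace false

open Literature.Computability.Complexity Filter Finset

namespace Summit.PneNP.PneNP.Theorems.CliqueExtLowerBound.WidthThreshold.AlgebraicReplaceableHelpers

section General
variable {ι : Type*} {n : ℕ}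
/-- The one-gate constant circuit `Circuit.const (Fin n) b` is a circuit over `{∧₂, ∨₂, 0, 1}`. -/
theorem const_isOver (b : Bool) : (Circuit.const (Fin n) b).IsOver monotoneBasis01 := by
  intro g hg
  obtain rfl : g = ⟨0, fun _ => b, Fin.elim0⟩ := by simpa [Circuit.const] using hg
  cases b
  · exact Set.mem_insert_of_mem _ (Set.mem_insert _ _)
  · exact Set.mem_insert _ _
/-- The positive-side error set of the constant `0` is the set of positives accepted by `f`
(so `0` is a replacement IFF `f ∘ dv` accepts few positives). -/
theorem const_false_pos_error_eq (f : (Fin n → Bool) → Bool) (dv : (ι → Bool) → Fin n → Bool)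
    (P : Finset (ι → Bool)) :
    P.filter (fun x => f (dv x) = true ∧ (Circuit.const (Fin n) false).eval (dv x) = false) =
      P.filter fun x => f (dv x) = true :=
  filter_congr fun x _ => by simp
/-- The negative-side error set of the constant `1` is the set of negatives rejected by `f`
(so `1` is a replacement IFF `f ∘ cv` rejects few negatives). -/
theorem const_true_neg_error_eq (f : (Fin n → Bool) → Bool) (cv : (ι → Bool) → Fin n → Bool)
    (N : Finset (ι → Bool)) :
    N.filter (fun x => (Circuit.const (Fin n) true).eval (cv x) = true ∧ f (cv x) = false) =
      N.filter fun x => f (cv x) = false :=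
  filter_congr fun x _ => by simp

/-- **Upper dominance** on the positive patterns empties the positive-side error set. -/
theorem filter_pos_eq_empty_of_upper (f : (Fin n → Bool) → Bool) (Ψ : Circuit (Fin n))
    (dv : (ι → Bool) → Fin n → Bool) (P : Finset (ι → Bool))
    (hup : ∀ x ∈ P, f (dv x) = true → Ψ.eval (dv x) = true) :
    P.filter (fun x => f (dv x) = true ∧ Ψ.eval (dv x) = false) = ∅ :=
  filter_eq_empty_iff.2 fun x hx h => by simpa [h.2] using hup x hx h.1

/-- **Lower dominance** on the negative patterns empties the negative-side error set. -/
theorem filter_neg_eq_empty_of_lower (f : (Fin n → Bool) → Bool) (Ψ : Circuit (Fin n))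
    (cv : (ι → Bool) → Fin n → Bool) (N : Finset (ι → Bool))
    (hlow : ∀ x ∈ N, Ψ.eval (cv x) = true → f (cv x) = true) :
    N.filter (fun x => Ψ.eval (cv x) = true ∧ f (cv x) = false) = ∅ :=
  filter_eq_empty_iff.2 fun x hx h => by simpa [h.2] using hlow x hx h.1

/-- **An upper bound (on the positive patterns) with small negative slack is a replacement.** If
`Ψ ≥ f` on the patterns `dv x`, `x ∈ P` (e.g. `Ψ ≥ f` pointwise) and `Ψ` exceeds `f` on at most
`ε · #N` negatives (through `cv`), then `Ψ` replaces `f`. -/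
theorem exists_replacement_of_upper (f : (Fin n → Bool) → Bool) (Ψ : Circuit (Fin n))
    (hΨ : Ψ.IsOver monotoneBasis01) (dv cv : (ι → Bool) → Fin n → Bool) (P N : Finset (ι → Bool))
    (hup : ∀ x ∈ P, f (dv x) = true → Ψ.eval (dv x) = true) {ε : ℝ} (hε : 0 ≤ ε)
    {a : ℕ} (ha : Ψ.size ≤ a)
    (hN : (#(N.filter fun x => Ψ.eval (cv x) = true ∧ f (cv x) = false) : ℝ) ≤ ε * #N) :
    ∃ Ψ : Circuit (Fin n), Ψ.IsOver monotoneBasis01 ∧ Ψ.size ≤ a ∧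
      (#(P.filter fun x => f (dv x) = true ∧ Ψ.eval (dv x) = false) : ℝ) ≤ ε * #P ∧
      (#(N.filter fun x => Ψ.eval (cv x) = true ∧ f (cv x) = false) : ℝ) ≤ ε * #N := by
  refine ⟨Ψ, hΨ, ha, ?_, hN⟩
  rw [filter_pos_eq_empty_of_upper f Ψ dv P hup, card_empty, Nat.cast_zero]
  positivity

/-- **A lower bound (on the negative patterns) with small positive slack is a replacement.** If
`Ψ ≤ f` on the patterns `cv x`, `x ∈ N` (e.g. `Ψ ≤ f` pointwise) and `f` exceeds `Ψ` on at most
`ε · #P` positives (through `dv`), then `Ψ` replaces `f`. -/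
theorem exists_replacement_of_lower (f : (Fin n → Bool) → Bool) (Ψ : Circuit (Fin n))
    (hΨ : Ψ.IsOver monotoneBasis01) (dv cv : (ι → Bool) → Fin n → Bool) (P N : Finset (ι → Bool))
    (hlow : ∀ x ∈ N, Ψ.eval (cv x) = true → f (cv x) = true) {ε : ℝ} (hε : 0 ≤ ε)
    {a : ℕ} (ha : Ψ.size ≤ a)
    (hP : (#(P.filter fun x => f (dv x) = true ∧ Ψ.eval (dv x) = false) : ℝ) ≤ ε * #P) :
    ∃ Ψ : Circuit (Fin n), Ψ.IsOver monotoneBasis01 ∧ Ψ.size ≤ a ∧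
      (#(P.filter fun x => f (dv x) = true ∧ Ψ.eval (dv x) = false) : ℝ) ≤ ε * #P ∧
      (#(N.filter fun x => Ψ.eval (cv x) = true ∧ f (cv x) = false) : ℝ) ≤ ε * #N := by
  refine ⟨Ψ, hΨ, ha, hP, ?_⟩
  rw [filter_neg_eq_empty_of_lower f Ψ cv N hlow, card_empty, Nat.cast_zero]
  positivity

/-- **Blind on the positives ⇒ replaceable by the constant `0`** (one gate; no hypothesis on `f`):
it suffices that `f` accepts, through `dv`, at most `ε · #P` of the positives. -/
theorem exists_replacement_of_pos_blind (f : (Fin n → Bool) → Bool)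
    (dv cv : (ι → Bool) → Fin n → Bool) (P N : Finset (ι → Bool)) {ε : ℝ} (hε : 0 ≤ ε)
    {a : ℕ} (ha : 1 ≤ a) (hP : (#(P.filter fun x => f (dv x) = true) : ℝ) ≤ ε * #P) :
    ∃ Ψ : Circuit (Fin n), Ψ.IsOver monotoneBasis01 ∧ Ψ.size ≤ a ∧
      (#(P.filter fun x => f (dv x) = true ∧ Ψ.eval (dv x) = false) : ℝ) ≤ ε * #P ∧
      (#(N.filter fun x => Ψ.eval (cv x) = true ∧ f (cv x) = false) : ℝ) ≤ ε * #N := by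
  refine exists_replacement_of_lower f (Circuit.const (Fin n) false) (const_isOver false) dv cv P N
    (fun x _ hv => absurd hv (by simp)) hε (by simpa using ha) ?_
  rwa [const_false_pos_error_eq]

/-- **Blind on the negatives ⇒ replaceable by the constant `1`** (one gate; no hypothesis on `f`):
it suffices that `f` rejects, through `cv`, at most `ε · #N` of the negatives. -/
theorem exists_replacement_of_neg_blind (f : (Fin n → Bool) → Bool)
    (dv cv : (ι → Bool) → Fin n → Bool) (P N : Finset (ι → Bool)) {ε : ℝ} (hε : 0 ≤ ε)
    {a : ℕ} (ha : 1 ≤ a) (hN : (#(N.filter fun x => f (cv x) = false) : ℝ) ≤ ε * #N) :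
    ∃ Ψ : Circuit (Fin n), Ψ.IsOver monotoneBasis01 ∧ Ψ.size ≤ a ∧
      (#(P.filter fun x => f (dv x) = true ∧ Ψ.eval (dv x) = false) : ℝ) ≤ ε * #P ∧
      (#(N.filter fun x => Ψ.eval (cv x) = true ∧ f (cv x) = false) : ℝ) ≤ ε * #N := by
  refine exists_replacement_of_upper f (Circuit.const (Fin n) true) (const_isOver true) dv cv P N
    (fun x _ _ => by simp) hε (by simpa using ha) ?_
  rwa [const_true_neg_error_eq]

/-- **Exact case**: a gate computed by a `{∧₂, ∨₂, 0, 1}`-circuit `Ψ` is replaced by `Ψ` exactly. -/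
theorem exists_replacement_of_computes (f : (Fin n → Bool) → Bool) (Ψ : Circuit (Fin n))
    (hΨ : Ψ.IsOver monotoneBasis01) (hc : ∀ v, Ψ.eval v = f v)
    (dv cv : (ι → Bool) → Fin n → Bool) (P N : Finset (ι → Bool)) {ε : ℝ} (hε : 0 ≤ ε)
    {a : ℕ} (ha : Ψ.size ≤ a) :
    ∃ Ψ : Circuit (Fin n), Ψ.IsOver monotoneBasis01 ∧ Ψ.size ≤ a ∧
      (#(P.filter fun x => f (dv x) = true ∧ Ψ.eval (dv x) = false) : ℝ) ≤ ε * #P ∧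
      (#(N.filter fun x => Ψ.eval (cv x) = true ∧ f (cv x) = false) : ℝ) ≤ ε * #N := by
  refine exists_replacement_of_upper f Ψ hΨ dv cv P N (fun x _ hv => (hc _).trans hv) hε ha ?_
  rw [filter_neg_eq_empty_of_lower f Ψ cv N fun x _ hv => (hc _).symm.trans hv]
  simp; positivity

/-- Over `{∧₂, ∨₂, 0, 1}` the AND of a list of positions costs `≤ length + 1` gates. -/
theorem cktSize_all01 {κ : Type*} (l : List κ) :
    CktSize monotoneBasis01 (fun (x : κ → Bool) (_ : Unit) => l.all fun i => x i)
      (l.length + 1) := by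
  rcases eq_or_ne l [] with rfl | hl
  · exact ((CktSize.gate (B := monotoneBasis01) (ι := κ) (GateFn.const true)
      (Set.mem_insert _ _) Fin.elim0).of_le (by simp)).congr fun x _ => by simp [GateFn.const]
  · exact ((cktSize_all l hl).basis_mono monotoneBasis_subset_monotoneBasis01).of_le
      (Nat.le_succ _)

/-- Over `{∧₂, ∨₂, 0, 1}` the OR of a list of positions costs `≤ length + 1` gates. -/
theorem cktSize_any01 {κ : Type*} (l : List κ) :
    CktSize monotoneBasis01 (fun (x : κ → Bool) (_ : Unit) => l.any fun i => x i)
      (l.length + 1) := by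
  rcases eq_or_ne l [] with rfl | hl
  · exact ((CktSize.gate (B := monotoneBasis01) (ι := κ) (GateFn.const false)
      (Set.mem_insert_of_mem _ (Set.mem_insert _ _)) Fin.elim0).of_le (by simp)).congr
      fun x _ => by simp [GateFn.const]
  · exact ((cktSize_any l hl).basis_mono monotoneBasis_subset_monotoneBasis01).of_le
      (Nat.le_succ _)

/-- **A monotone DNF over the input positions is a `{∧₂, ∨₂, 0, 1}`-circuit with at most
`∑_{R ∈ F} (#R + 1) + #F + 1` gates** (all ANDs in parallel, then one OR chain). -/
theorem exists_circuit_dnf (F : Finset (Finset (Fin n))) :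
    ∃ Ψ : Circuit (Fin n), Ψ.IsOver monotoneBasis01 ∧
      Ψ.size ≤ ∑ R ∈ F, (#R + 1) + (#F + 1) ∧
      ∀ v, Ψ.eval v = true ↔ ∃ R ∈ F, ∀ j ∈ R, v j = true := by
  classical
  have h1 : CktSize monotoneBasis01
      (fun (v : Fin n → Bool) (R : F) => R.1.toList.all fun j => v j)
      (∑ R : F, (R.1.toList.length + 1)) :=
    CktSize.pi fun R => cktSize_all01 R.1.toList
  obtain ⟨Ψ, hΨ, hs, he⟩ := (h1.comp (cktSize_any01 (univ : Finset F).toList)).toCircuit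
  refine ⟨Ψ, hΨ, hs.trans (le_of_eq ?_), fun v => ?_⟩
  · simp only [length_toList, card_univ, Fintype.card_coe]
    rw [Finset.sum_coe_sort F fun R => #R + 1]
  · rw [he v, List.any_eq_true]
    simp only [mem_toList, mem_univ, true_and, List.all_eq_true, Subtype.exists, exists_prop]

/-- **A monotone CNF over the input positions is a `{∧₂, ∨₂, 0, 1}`-circuit with at most
`∑_{S ∈ F} (#S + 1) + #F + 1` gates.** -/
theorem exists_circuit_cnf (F : Finset (Finset (Fin n))) :
    ∃ Ψ : Circuit (Fin n), Ψ.IsOver monotoneBasis01 ∧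
      Ψ.size ≤ ∑ S ∈ F, (#S + 1) + (#F + 1) ∧
      ∀ v, Ψ.eval v = true ↔ ∀ S ∈ F, ∃ j ∈ S, v j = true := by
  classical
  have h1 : CktSize monotoneBasis01
      (fun (v : Fin n → Bool) (S : F) => S.1.toList.any fun j => v j)
      (∑ S : F, (S.1.toList.length + 1)) :=
    CktSize.pi fun S => cktSize_any01 S.1.toList
  obtain ⟨Ψ, hΨ, hs, he⟩ := (h1.comp (cktSize_all01 (univ : Finset F).toList)).toCircuit
  refine ⟨Ψ, hΨ, hs.trans (le_of_eq ?_), fun v => ?_⟩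
  · simp only [length_toList, card_univ, Fintype.card_coe]
    rw [Finset.sum_coe_sort F fun S => #S + 1]
  · rw [he v, List.all_eq_true]
    simp only [mem_toList, mem_univ, true_imp_iff, List.any_eq_true, Subtype.forall]

/-- **Certificate sparsity.** If every `S ∈ F` is a sound rejection certificate of `f` (all
positions of `S` off forces rejection: `f ≤ ⋁_S`) and at most `ε · #N` negatives are rejected by `f`
through `cv` WITHOUT being certified by some `S ∈ F`, then the CNF `⋀_{S ∈ F} ⋁_S` replaces `f`
(no positive-side error at all). -/
theorem exists_replacement_of_cuts (f : (Fin n → Bool) → Bool) (F : Finset (Finset (Fin n)))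
    (hsound : ∀ S ∈ F, ∀ v, f v = true → ∃ j ∈ S, v j = true)
    (dv cv : (ι → Bool) → Fin n → Bool) (P N : Finset (ι → Bool)) {ε : ℝ} (hε : 0 ≤ ε)
    {a : ℕ} (ha : ∑ S ∈ F, (#S + 1) + (#F + 1) ≤ a)
    (hN : (#(N.filter fun x => (∀ S ∈ F, ∃ j ∈ S, cv x j = true) ∧ f (cv x) = false) : ℝ)
      ≤ ε * #N) :
    ∃ Ψ : Circuit (Fin n), Ψ.IsOver monotoneBasis01 ∧ Ψ.size ≤ a ∧
      (#(P.filter fun x => f (dv x) = true ∧ Ψ.eval (dv x) = false) : ℝ) ≤ ε * #P ∧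
      (#(N.filter fun x => Ψ.eval (cv x) = true ∧ f (cv x) = false) : ℝ) ≤ ε * #N := by
  obtain ⟨Ψ, hΨ, hs, he⟩ := exists_circuit_cnf F
  refine exists_replacement_of_upper f Ψ hΨ dv cv P N
    (fun x _ hv => (he _).2 fun S hS => hsound S hS _ hv) hε (hs.trans ha) ?_
  simpa only [he] using hN

/-- **Effective minterm width.** If every `R ∈ F` is a term below `f` (all positions of `R` on
forces acceptance: `⋀_R ≤ f`) and at most `ε · #P` positives are accepted by `f` through `dv`
WITHOUT switching on some `R ∈ F` entirely, then the DNF `⋁_{R ∈ F} ⋀_R` replaces `f` (no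
negative-side error at all). -/
theorem exists_replacement_of_minterms (f : (Fin n → Bool) → Bool) (F : Finset (Finset (Fin n)))
    (hmin : ∀ R ∈ F, ∀ v, (∀ j ∈ R, v j = true) → f v = true)
    (dv cv : (ι → Bool) → Fin n → Bool) (P N : Finset (ι → Bool)) {ε : ℝ} (hε : 0 ≤ ε)
    {a : ℕ} (ha : ∑ R ∈ F, (#R + 1) + (#F + 1) ≤ a)
    (hP : (#(P.filter fun x => f (dv x) = true ∧ ¬ ∃ R ∈ F, ∀ j ∈ R, dv x j = true) : ℝ)
      ≤ ε * #P) :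
    ∃ Ψ : Circuit (Fin n), Ψ.IsOver monotoneBasis01 ∧ Ψ.size ≤ a ∧
      (#(P.filter fun x => f (dv x) = true ∧ Ψ.eval (dv x) = false) : ℝ) ≤ ε * #P ∧
      (#(N.filter fun x => Ψ.eval (cv x) = true ∧ f (cv x) = false) : ℝ) ≤ ε * #N := by
  obtain ⟨Ψ, hΨ, hs, he⟩ := exists_circuit_dnf F
  refine exists_replacement_of_lower f Ψ hΨ dv cv P N (fun x _ hv => ?_) hε (hs.trans ha) ?_
  · obtain ⟨R, hR, hv⟩ := (he _).1 hv
    exact hmin R hR _ hv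
  · have : P.filter (fun x => f (dv x) = true ∧ Ψ.eval (dv x) = false) =
        P.filter fun x => f (dv x) = true ∧ ¬ ∃ R ∈ F, ∀ j ∈ R, dv x j = true :=
      filter_congr fun x _ => and_congr_right fun _ => by rw [← he (dv x)]; simp
    rwa [this]

/-- Size bookkeeping for pattern families with members of size `≤ W`. -/
theorem sum_image_card_succ_le (T : Finset (Fin n → Bool)) (g : (Fin n → Bool) → Finset (Fin n))
    {W : ℕ} (hg : ∀ t ∈ T, #(g t) ≤ W) :
    ∑ R ∈ T.image g, (#R + 1) + (#(T.image g) + 1) ≤ (W + 2) * #T + 1 := by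
  have h1 : ∑ R ∈ T.image g, (#R + 1) ≤ #(T.image g) * (W + 1) := by
    have := Finset.sum_le_card_nsmul (T.image g) (fun R => #R + 1) (W + 1) fun R hR => by
      obtain ⟨t, ht, rfl⟩ := mem_image.1 hR
      simpa using hg t ht
    simpa [smul_eq_mul] using this
  have h2 : #(T.image g) ≤ #T := card_image_le
  nlinarith

/-- **OR of accepted patterns (canonical lower sandwich).** For a MONOTONE `f`, a map `ρ` of the
positions (a representative of each class of positions carrying the same children: all patterns
are then `ρ`-invariant and `#ρ(univ)` = number of distinct children; or `ρ = id`) and a finite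
family `T` of `ρ`-invariant accepted patterns, the DNF `⋁_{t ∈ T} ⋀_{j ∈ ρ(supp t)} w_j` has
`≤ (#ρ(univ) + 2) · #T + 1` gates, accepts every `t ∈ T`, and lies below `f` on all `ρ`-invariant
inputs. -/
theorem exists_circuit_orPatterns (f : (Fin n → Bool) → Bool) (hf : Monotone f) (ρ : Fin n → Fin n)
    (T : Finset (Fin n → Bool)) (hT : ∀ t ∈ T, f t = true) (hTρ : ∀ t ∈ T, ∀ j, t (ρ j) = t j) :
    ∃ Ψ : Circuit (Fin n), Ψ.IsOver monotoneBasis01 ∧ Ψ.size ≤ (#(univ.image ρ) + 2) * #T + 1 ∧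
      (∀ v, (∀ j, v (ρ j) = v j) → Ψ.eval v = true → f v = true) ∧ ∀ t ∈ T, Ψ.eval t = true := by
  classical
  have hd := exists_circuit_dnf
    (T.image fun t => ((univ : Finset (Fin n)).filter fun j => t j = true).image ρ)
  obtain ⟨Ψ, hΨ, hs, he⟩ := hd
  refine ⟨Ψ, hΨ, hs.trans (sum_image_card_succ_le T _ fun t _ => card_le_card
    (image_subset_image (filter_subset _ _))), fun v hv hΨv => ?_, fun t ht => (he t).2
      ⟨_, mem_image_of_mem _ ht, fun i hi => ?_⟩⟩
  · obtain ⟨R, hR, hall⟩ := (he v).1 hΨv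
    obtain ⟨t, ht, rfl⟩ := mem_image.1 hR
    refine eq_true_of_le_of_eq_true (hf fun j => ?_) (hT t ht)
    cases htj : t j
    · exact Bool.false_le _
    · rw [← hv j, hall (ρ j) (mem_image_of_mem _ (mem_filter.2 ⟨mem_univ _, htj⟩))]
  · obtain ⟨j, hj, rfl⟩ := mem_image.1 hi
    rw [hTρ t ht, (mem_filter.1 hj).2]

/-- **AND of co-clauses of rejected patterns (canonical upper sandwich).** Dually, for a finite
family `T` of `ρ`-invariant rejected patterns, the CNF `⋀_{t ∈ T} ⋁_{j ∈ ρ(cosupp t)} w_j` has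
`≤ (#ρ(univ) + 2) · #T + 1` gates, rejects every `t ∈ T`, and lies above `f` on all
`ρ`-invariant inputs. -/
theorem exists_circuit_andCoPatterns (f : (Fin n → Bool) → Bool) (hf : Monotone f)
    (ρ : Fin n → Fin n) (T : Finset (Fin n → Bool)) (hT : ∀ t ∈ T, f t = false)
    (hTρ : ∀ t ∈ T, ∀ j, t (ρ j) = t j) :
    ∃ Ψ : Circuit (Fin n), Ψ.IsOver monotoneBasis01 ∧ Ψ.size ≤ (#(univ.image ρ) + 2) * #T + 1 ∧
      (∀ v, (∀ j, v (ρ j) = v j) → f v = true → Ψ.eval v = true) ∧ ∀ t ∈ T, Ψ.eval t = false := by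
  classical
  have hc := exists_circuit_cnf
    (T.image fun t => ((univ : Finset (Fin n)).filter fun j => t j = false).image ρ)
  obtain ⟨Ψ, hΨ, hs, he⟩ := hc
  refine ⟨Ψ, hΨ, hs.trans (sum_image_card_succ_le T _ fun t _ => card_le_card
    (image_subset_image (filter_subset _ _))), fun v hv hfv => (he v).2 fun S hS => ?_,
    fun t ht => ?_⟩
  · obtain ⟨t, ht, rfl⟩ := mem_image.1 hS
    by_contra hno
    push Not at hno
    have hvt : v ≤ t := fun j => by
      cases hvj : v j
      · exact Bool.false_le _
      · cases htj : t j
        · refine absurd ?_ (hno (ρ j) (mem_image_of_mem _ (mem_filter.2 ⟨mem_univ _, htj⟩)))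
          rw [hv j, hvj]
        · exact le_rfl
    exact Bool.false_ne_true ((hT t ht).symm.trans (eq_true_of_le_of_eq_true (hf hvt) hfv))
  · refine Bool.eq_false_iff.2 fun h => ?_
    obtain ⟨i, hi, hti⟩ := (he t).1 h _ (mem_image_of_mem _ ht)
    obtain ⟨j, hj, rfl⟩ := mem_image.1 hi
    rw [hTρ t ht, (mem_filter.1 hj).2] at hti
    exact Bool.false_ne_true hti

/-- **Replacement by the OR of accepted positive patterns** (monotone `f`; `ρ` a representative map
under which both push-forwards are invariant, e.g. `ρ = id`): for any finite family `T` of accepted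
positive-side patterns, `f` is replaceable with `≤ (#ρ(univ) + 2) · #T + 1` gates, the only errors
being the accepted positives whose pattern `dv x` is not in `T` (ZERO error if `T` = all). -/
theorem exists_replacement_of_posPatterns (f : (Fin n → Bool) → Bool) (hf : Monotone f)
    (ρ : Fin n → Fin n) (dv cv : (ι → Bool) → Fin n → Bool) (hdv : ∀ x j, dv x (ρ j) = dv x j)
    (hcv : ∀ x j, cv x (ρ j) = cv x j) (T : Finset (Fin n → Bool)) (hT : ∀ t ∈ T, f t = true)
    (hTd : ∀ t ∈ T, ∃ x, dv x = t) (P N : Finset (ι → Bool)) {ε : ℝ} (hε : 0 ≤ ε)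
    {a : ℕ} (ha : (#(univ.image ρ) + 2) * #T + 1 ≤ a)
    (hP : (#(P.filter fun x => f (dv x) = true ∧ dv x ∉ T) : ℝ) ≤ ε * #P) :
    ∃ Ψ : Circuit (Fin n), Ψ.IsOver monotoneBasis01 ∧ Ψ.size ≤ a ∧
      (#(P.filter fun x => f (dv x) = true ∧ Ψ.eval (dv x) = false) : ℝ) ≤ ε * #P ∧
      (#(N.filter fun x => Ψ.eval (cv x) = true ∧ f (cv x) = false) : ℝ) ≤ ε * #N := by
  obtain ⟨Ψ, hΨ, hs, hlow, hT'⟩ := exists_circuit_orPatterns f hf ρ T hT fun t ht j => by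
    obtain ⟨x, rfl⟩ := hTd t ht; exact hdv x j
  refine exists_replacement_of_lower f Ψ hΨ dv cv P N (fun x _ => hlow _ (hcv x)) hε
    (hs.trans ha) (le_trans ?_ hP)
  exact_mod_cast card_le_card fun x hx => by
    rw [mem_filter] at hx ⊢
    exact ⟨hx.1, hx.2.1, fun hxT => by simpa [hT' _ hxT] using hx.2.2⟩

/-- **Replacement by the AND of co-clauses of rejected negative patterns** (monotone `f`): dually,
the only errors being the rejected negatives whose pattern `cv x` is not in `T`. -/
theorem exists_replacement_of_negPatterns (f : (Fin n → Bool) → Bool) (hf : Monotone f)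
    (ρ : Fin n → Fin n) (dv cv : (ι → Bool) → Fin n → Bool) (hdv : ∀ x j, dv x (ρ j) = dv x j)
    (hcv : ∀ x j, cv x (ρ j) = cv x j) (T : Finset (Fin n → Bool)) (hT : ∀ t ∈ T, f t = false)
    (hTc : ∀ t ∈ T, ∃ x, cv x = t) (P N : Finset (ι → Bool)) {ε : ℝ} (hε : 0 ≤ ε)
    {a : ℕ} (ha : (#(univ.image ρ) + 2) * #T + 1 ≤ a)
    (hN : (#(N.filter fun x => f (cv x) = false ∧ cv x ∉ T) : ℝ) ≤ ε * #N) :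
    ∃ Ψ : Circuit (Fin n), Ψ.IsOver monotoneBasis01 ∧ Ψ.size ≤ a ∧
      (#(P.filter fun x => f (dv x) = true ∧ Ψ.eval (dv x) = false) : ℝ) ≤ ε * #P ∧
      (#(N.filter fun x => Ψ.eval (cv x) = true ∧ f (cv x) = false) : ℝ) ≤ ε * #N := by
  obtain ⟨Ψ, hΨ, hs, hup, hT'⟩ := exists_circuit_andCoPatterns f hf ρ T hT fun t ht j => by
    obtain ⟨x, rfl⟩ := hTc t ht; exact hcv x j
  refine exists_replacement_of_upper f Ψ hΨ dv cv P N (fun x _ => hup _ (hdv x)) hε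
    (hs.trans ha) (le_trans ?_ hN)
  exact_mod_cast card_le_card fun x hx => by
    rw [mem_filter] at hx ⊢
    exact ⟨hx.1, hx.2.2, fun hxT => by simpa [hT' _ hxT] using hx.2.1⟩

end General
open Classical in
/-- **Stub shape from a cheap exit.** For ANY gate `φ` and child tuples `D, C` over the edge slots
of `K_m` (`1 ≤ m`): if `φ` accepts through the DNF children at most `ε(m,c) · #P` of the bare
`⌈m^{1/4}⌉₊`-cliques, OR rejects through the CNF children at most `ε(m,c) · #N` of the complements
of the `#E/⌊m^{1/8}⌋₊`-subsets, OR `φ.2` has a `{∧₂, ∨₂, 0, 1}`-circuit with `≤ m^a` gates, then the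
conclusion of `stub_algebraicReplaceable` / `stub_convReplaceable` holds for `φ, D, C` verbatim. -/
theorem conclusion_of_cheap_exit : ∀ (m : ℕ), 1 ≤ m → ∀ (c a : ℕ) (φ : GateFn)
    (D C : Fin φ.1 → Finset (Finset ((⊤ : SimpleGraph (Fin m)).edgeSet))),
    ((#((posGraphs m ⌈(m : ℝ) ^ (1 / 4 : ℝ)⌉₊).filter
          (fun x => φ.2 (fun j => decide (EvalDNF (D j) x)) = true)) : ℝ)
        ≤ (1 / (8 * (m : ℝ) ^ (c + 1))) * #(posGraphs m ⌈(m : ℝ) ^ (1 / 4 : ℝ)⌉₊) ∨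
      (#((((powersetCard (Fintype.card ((⊤ : SimpleGraph (Fin m)).edgeSet) / ⌊(m : ℝ) ^ (1 / 8 : ℝ)⌋₊)
      (univ : Finset ((⊤ : SimpleGraph (Fin m)).edgeSet))).image (fun M => fun e => decide (e ∉ M)))).filter
          (fun x => φ.2 (fun j => decide (EvalCNF (C j) x)) = false)) : ℝ)
        ≤ (1 / (8 * (m : ℝ) ^ (c + 1))) *
          #(((powersetCard (Fintype.card ((⊤ : SimpleGraph (Fin m)).edgeSet) / ⌊(m : ℝ) ^ (1 / 8 : ℝ)⌋₊)
      (univ : Finset ((⊤ : SimpleGraph (Fin m)).edgeSet))).image (fun M => fun e => decide (e ∉ M)))) ∨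
      ∃ Ψ₀ : Circuit (Fin φ.1), Ψ₀.IsOver monotoneBasis01 ∧ Ψ₀.size ≤ m ^ a ∧
        ∀ v, Ψ₀.eval v = φ.2 v) →
    ∃ Ψ : Circuit (Fin φ.1), Ψ.IsOver monotoneBasis01 ∧ Ψ.size ≤ m ^ a ∧
      (#((posGraphs m ⌈(m : ℝ) ^ (1 / 4 : ℝ)⌉₊).filter
          (fun x => φ.2 (fun j => decide (EvalDNF (D j) x)) = true ∧
            Ψ.eval (fun j => decide (EvalDNF (D j) x)) = false)) : ℝ)
        ≤ (1 / (8 * (m : ℝ) ^ (c + 1))) * #(posGraphs m ⌈(m : ℝ) ^ (1 / 4 : ℝ)⌉₊) ∧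
      (#((((powersetCard (Fintype.card ((⊤ : SimpleGraph (Fin m)).edgeSet) / ⌊(m : ℝ) ^ (1 / 8 : ℝ)⌋₊)
      (univ : Finset ((⊤ : SimpleGraph (Fin m)).edgeSet))).image (fun M => fun e => decide (e ∉ M)))).filter
          (fun x => Ψ.eval (fun j => decide (EvalCNF (C j) x)) = true ∧
            φ.2 (fun j => decide (EvalCNF (C j) x)) = false)) : ℝ)
        ≤ (1 / (8 * (m : ℝ) ^ (c + 1))) *
          #(((powersetCard (Fintype.card ((⊤ : SimpleGraph (Fin m)).edgeSet) / ⌊(m : ℝ) ^ (1 / 8 : ℝ)⌋₊)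
      (univ : Finset ((⊤ : SimpleGraph (Fin m)).edgeSet))).image (fun M => fun e => decide (e ∉ M)))) := by
  intro m hm c a φ D C h
  rcases h with h | h | ⟨Ψ₀, h₀, hs, hc⟩
  · exact exists_replacement_of_pos_blind φ.2 _ _ _ _ (by positivity) (Nat.one_le_pow _ _ hm) h
  · exact exists_replacement_of_neg_blind φ.2 _ _ _ _ (by positivity) (Nat.one_le_pow _ _ hm) h
  · exact exists_replacement_of_computes φ.2 Ψ₀ h₀ hc _ _ _ _ (by positivity) hs

end Summit.PneNP.PneNP.Theorems.CliqueExtLowerBound.WidthThreshold.AlgebraicReplaceableHelpers
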